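import Mathlib
import Literature.NumberTheory.Sieve.IntervalResidueClassSieveSigned
import Literature.NumberTheory.Sieve.IntervalResidueClassSieve
import Literature.NumberTheory.Sieve.BombieriVinogradovLiouvilleHeights
import Literature.NumberTheory.Sieve.RoughDivisorPowerSums
import Summits.Parity.GeneralizedHardyLittlewood.Theorems.ParityLeakOneFifthPlainSplitRoughMass
import Summits.Parity.GeneralizedHardyLittlewood.Theorems.ParityLeakOneFifthPlainSplitTwistedModel
import Summits.Parity.GeneralizedHardyLittlewood.Theorems.ParityLeakOneFifthPlainSplitTwistedSd
import Summits.Parity.GeneralizedHardyLittlewood.Theorems.ParityLeakOneFifthPlainSplitTwistedGrowth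
import Summits.Parity.GeneralizedHardyLittlewood.Theorems.ParityLeakOneFifthPlainSplitAssembly
import Summits.Parity.BatemanHorn.Theorems.IsogenyRedeiOmegaToMobiusAPSieve
import HarnessLib

/-!
# Route ParityLeakOneFifth, crux `PlainSplit` (stmt-Parity-18382): the last stub and the crux

`|A_w| ≤ δ V x/log x` for `ε ≤ ε₀(δ)`, `x ≥ x₀(ε)`, where
`A_w = Σ_{n ∈ (x,2x], n z-rough, P⁻(n+2) ≥ w} λ(n+2) G(n+2)`, `G(m) = Σ_{d ∣ m, d ≤ D, d y-rough} μ(d)`,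
`y = x^{1/5}`, `D = x^{1/2−2ε}`, `w = x^{ε²}`, `z = exp((log log x)²)`, `V = ∏_{p<z}(1 − 1/p)`.
Proof: `A_w = Σ_d μ(d) S_d` (part I); each `|S_d|` is bounded by the signed interval sieve at level
`L = x^{1/8}` with Bombieri–Vinogradov for `λ` (parts II–V, `twisted_Sd_le`); the totals of the
main terms (`u e^{-u}`-small, `u = 1/(8ε²)`, with `Σ_{d y-rough ≤ D} 1/d ≤ 5C_R/2`), of the
`L²`-terms and of the remainders are each `≤ (δ/4) V x/log x` (part VI).

Finally `plainSplit`: the crux `PlainSplit : CalibratedE1 → PintzDensity → E1NonSaturation` BY NAME,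
from `plainSplit_of_twisted` (file `…PlainSplitAssembly.lean`: the composition of line `calib-split`
from the five stubs, the model mass and the rough Liouville stubs) and the stub just proved.
-/

namespace Summit.Parity.GeneralizedHardyLittlewood.Theorems.ParityLeakOneFifth

open Finset
open Literature.NumberTheory.Sieve

/-- `u e^{-u} ≤ 2/u` for `u > 0`. -/
theorem mul_exp_neg_le {u : ℝ} (hu : 0 < u) : u * Real.exp (-u) ≤ 2 / u := by
  have h := Real.quadratic_le_exp_of_nonneg hu.le
  have h2 : u ^ 2 / 2 ≤ Real.exp u := by nlinarith
  rw [Real.exp_neg, ← div_eq_mul_inv, div_le_div_iff₀ (Real.exp_pos u) hu]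
  nlinarith

/-- Summing an affine function of `1/d`. -/
theorem sum_affine_inv (S : Finset ℕ) (α β : ℝ) :
    ∑ d ∈ S, (α * (1 / (d : ℝ)) + β) = α * ∑ d ∈ S, (1 : ℝ) / d + β * #S := by
  rw [Finset.sum_add_distrib, ← Finset.mul_sum, Finset.sum_const, nsmul_eq_mul]; ring

set_option maxHeartbeats 1600000 in
/-- **Stub `stub_roughLiouvilleTwistedSmall`** of skeleton `calib-split` (crux `PlainSplit`,
stmt-Parity-18382); see the module docstring. -/
theorem stub_roughLiouvilleTwistedSmall : ∀ δ : ℝ, 0 < δ → ∃ ε₀ : ℝ, 0 < ε₀ ∧ ∀ ε : ℝ, 0 < ε → ε ≤ ε₀ → ∃ x₀ : ℕ, ∀ x : ℕ, x₀ ≤ x → ∀ (z V : ℝ) (G : ℕ → ℝ), z = Real.exp (Real.log (Real.log (x : ℝ)) ^ 2) → V = ∏ p ∈ (Finset.range ⌈z⌉₊).filter Nat.Prime, (1 - 1 / (p : ℝ)) → G = (fun m : ℕ => ∑ d ∈ (Nat.divisors m).filter (fun d : ℕ => (d : ℝ) ≤ (x : ℝ) ^ ((1 : ℝ) / 2 -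 2 * ε) ∧ ∀ p ∈ d.primeFactors, (x : ℝ) ^ ((1 : ℝ) / 5) ≤ (p : ℝ)), (ArithmeticFunction.moebius d : ℝ)) → |∑ n ∈ (Finset.Ioc x (2 * x)).filter (fun n : ℕ => (∀ p ∈ n.primeFactors, z ≤ (p : ℝ)) ∧ (x : ℝ) ^ (ε ^ 2) ≤ ((n + 2).minFac : ℝ)), (ArithmeticFunction.liouville (n + 2) : ℝ) * G (n + 2)| ≤ δ * V * (x : ℝ) / Real.log (x : ℝ) := by
  intro δ hδ
  obtain ⟨C, hC, hFL⟩ := IntervalClassSieve.abs_signedSum_le 2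
  obtain ⟨c, hc, hVlow⟩ := IntervalClassSieve.le_prod_one_sub_card_div 1
  obtain ⟨B, Cb, X₀, hB, hCb, hBV⟩ := BVLiouvilleHeights.bv_liouvilleAP 3 (by norm_num)
  obtain ⟨CR, hCR, hRough⟩ := RoughSums.exists_sum_rough_sigma_zero_pow_div_le' 0
  -- the choice of `ε₀`
  have hKM0 : 0 < 64 * C * (5 / 2 * CR + 1) + 1 := by positivity
  have hη0 : 0 < δ / (64 * C * (5 / 2 * CR + 1) + 1) := by positivity
  refine ⟨min (1 / 25) (δ / (64 * C * (5 / 2 * CR + 1) + 1) / 16), lt_min (by norm_num)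
    (by positivity), fun ε hε hεle => ?_⟩
  have hε25 : ε ≤ 1 / 25 := hεle.trans (min_le_left _ _)
  have hεη : ε ≤ δ / (64 * C * (5 / 2 * CR + 1) + 1) / 16 := hεle.trans (min_le_right _ _)
  have hε2 : 0 < ε ^ 2 := by positivity
  -- thresholds in `t = log log x`
  obtain ⟨T₂, -, hT₂⟩ := exists_quadratic_le_exp (1 / ε ^ 2) 0 0
  obtain ⟨T₃, -, hT₃⟩ := exists_quadratic_le_exp 0 (16 * B) (16 * B * Real.log 2)
  obtain ⟨T₅, -, hT₅⟩ := exists_pow_four_le_mul_exp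
    (κ := 9 * δ * c / (5120 * (Cb + 1) * CR)) (by positivity)
  obtain ⟨T₆, -, hT₆⟩ := exists_pow_four_le_mul_exp (κ := (1 : ℝ)) one_pos
  obtain ⟨T₇, -, hT₇⟩ := exists_quadratic_le_exp 0 8 (4 * Real.log (4 / (δ * c)))
  obtain ⟨x₁, hx₁⟩ := exists_nat_loglog_ge
    (max (max (max T₂ T₃) (max T₅ T₆)) (max T₇ (max 2 (8 / 3 * max X₀ 1))))
  refine ⟨x₁, fun x hx z V G hz hV hG => ?_⟩
  obtain ⟨hxE, hlogx, hTt⟩ := hx₁ x hx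
  set t : ℝ := Real.log (Real.log (x : ℝ)) with ht
  have hT₂t := hT₂ t (le_trans (le_max_of_le_left (le_max_of_le_left (le_max_left _ _))) hTt)
  have hT₃t := hT₃ t (le_trans (le_max_of_le_left (le_max_of_le_left (le_max_right _ _))) hTt)
  have hT₅t := hT₅ t (le_trans (le_max_of_le_left (le_max_of_le_right (le_max_left _ _))) hTt)
  have hT₆t := hT₆ t (le_trans (le_max_of_le_left (le_max_of_le_right (le_max_right _ _))) hTt)
  have hT₇t := hT₇ t (le_trans (le_max_of_le_right (le_max_left _ _)) hTt)
  have ht2 : 2 ≤ t := le_trans (le_max_of_le_right (le_max_of_le_right (le_max_left _ _))) hTt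
  have hX₀t : 8 / 3 * max X₀ 1 ≤ t :=
    le_trans (le_max_of_le_right (le_max_of_le_right (le_max_right _ _))) hTt
  simp only [zero_mul, add_zero, zero_add, one_mul] at hT₂t hT₃t hT₆t hT₇t
  have ht1 : 1 ≤ t := by linarith
  have ht0 : 0 < t := by linarith
  -- `x`, `log x = e^t`
  have hx0 : (0 : ℝ) < x := (Real.exp_pos _).trans_le hxE
  have hlogpos : 0 < Real.log (x : ℝ) := (Real.exp_pos _).trans_le hlogx
  have hexpt : Real.exp t = Real.log (x : ℝ) := by rw [ht, Real.exp_log hlogpos]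
  have hxexp : Real.exp (Real.exp t) = (x : ℝ) := by rw [hexpt, Real.exp_log hx0]
  obtain ⟨hx4, hz2, hzw, hwL, hwy, hy1, hyD, hDx, hL1, hlogw, hlogL, hlogx', hxhalf⟩ :=
    twisted_params hε hε25 hx0 hxexp ht2 hT₂t
  have hzt : z = Real.exp (t ^ 2) := by rw [hz]
  rw [← hzt] at hz2 hzw
  have hlogz : Real.log z = t ^ 2 := by rw [hzt, Real.log_exp]
  have hx1 : (1 : ℝ) < x := by linarith
  have hx1' : 1 ≤ x := by exact_mod_cast hx1.le
  -- the parameters as variables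
  set y : ℝ := (x : ℝ) ^ ((1 : ℝ) / 5) with hy
  set Dr : ℝ := (x : ℝ) ^ ((1 : ℝ) / 2 - 2 * ε) with hDr
  set w : ℝ := (x : ℝ) ^ (ε ^ 2) with hw
  set L : ℝ := (x : ℝ) ^ ((1 : ℝ) / 8) with hL
  have hD0 : 0 < Dr := by linarith
  have hL0 : 0 < L := by linarith
  have hLexp : L = Real.exp (1 / 8 * Real.exp t) := by rw [← hlogL, Real.exp_log hL0]
  have hℓ0 : 0 < 3 / 8 * Real.log (x : ℝ) := by positivity
  -- `V ≥ c/t⁴`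
  have hPB : Nat.primesBelow ⌈z⌉₊ = (Finset.range ⌈z⌉₊).filter Nat.Prime := rfl
  have hVc : c / t ^ 4 ≤ V := by
    have h := hVlow (fun _ => ({0} : Finset ℕ)) (fun p _ => by rw [Finset.card_singleton])
      (fun p hp => by rw [Finset.card_singleton]; exact hp.one_lt) z hz2.le
    rw [hPB, hlogz] at h
    have e1 : (t ^ 2) ^ (2 * 1) = t ^ 4 := by ring
    rw [e1] at h
    refine h.trans (le_of_eq ?_)
    rw [hV]
    exact Finset.prod_congr rfl fun p _ => by rw [Finset.card_singleton, Nat.cast_one]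
  have ht4 : 0 < t ^ 4 := by positivity
  have hV0 : 0 < V := lt_of_lt_of_le (div_pos hc ht4) hVc
  -- the set of `d`
  have hDmem : ∀ d ∈ (Finset.Icc 1 ⌊Dr⌋₊).filter (fun d : ℕ => (d : ℝ) ≤ Dr ∧
      ∀ p ∈ d.primeFactors, y ≤ (p : ℝ)), 1 ≤ d ∧ (d : ℝ) ≤ Dr ∧ ∀ p ∈ d.primeFactors, y ≤ (p : ℝ) := by
    intro d hd
    rw [Finset.mem_filter, Finset.mem_Icc] at hd
    exact ⟨hd.1.1, hd.2.1, hd.2.2⟩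
  -- Step A: `A_w = Σ_d μ(d) S_d`
  have hA := sum_mul_sum_divisors_comm ((Finset.Ioc x (2 * x)).filter (fun n : ℕ =>
      (∀ p ∈ n.primeFactors, z ≤ (p : ℝ)) ∧ w ≤ ((n + 2).minFac : ℝ)))
    (fun n => (ArithmeticFunction.liouville (n + 2) : ℝ)) (fun d => (ArithmeticFunction.moebius d : ℝ))
    (fun d : ℕ => (d : ℝ) ≤ Dr ∧ ∀ p ∈ d.primeFactors, y ≤ (p : ℝ)) ⌊Dr⌋₊
    (fun d hd => Nat.le_floor hd.1)
  have hGm : ∀ m : ℕ, G m = ∑ d ∈ (Nat.divisors m).filter (fun d : ℕ => (d : ℝ) ≤ Dr ∧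
      ∀ p ∈ d.primeFactors, y ≤ (p : ℝ)), (ArithmeticFunction.moebius d : ℝ) := by
    intro m; rw [hG]
  simp only [hGm]
  rw [hA]
  -- Step B: the bound for each `d`
  have hSd : ∀ d ∈ (Finset.Icc 1 ⌊Dr⌋₊).filter (fun d : ℕ => (d : ℝ) ≤ Dr ∧
      ∀ p ∈ d.primeFactors, y ≤ (p : ℝ)),
      |(ArithmeticFunction.moebius d : ℝ) *
        ∑ n ∈ ((Finset.Ioc x (2 * x)).filter (fun n : ℕ => (∀ p ∈ n.primeFactors, z ≤ (p : ℝ)) ∧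
          w ≤ ((n + 2).minFac : ℝ))).filter (fun n => d ∣ n + 2),
          (ArithmeticFunction.liouville (n + 2) : ℝ)| ≤
      (C * x * (2 * V / Real.log w) * Real.exp (-(Real.log L / Real.log w)) +
        2 * Cb * (2 * (x : ℝ) + 2) * (1 + Real.log L) / (3 / 8 * Real.log (x : ℝ)) ^ 3) * (1 / (d : ℝ)) +
      (C * (2 * V / Real.log w) * Real.exp (-(Real.log L / Real.log w)) + L ^ 2) := by
    intro d hd
    obtain ⟨hd1, hdD, hdr⟩ := hDmem d hd
    have hd' : (0 : ℝ) < d := by exact_mod_cast hd1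
    have e1 : ∑ n ∈ ((Finset.Ioc x (2 * x)).filter (fun n : ℕ => (∀ p ∈ n.primeFactors,
        z ≤ (p : ℝ)) ∧ w ≤ ((n + 2).minFac : ℝ))).filter (fun n => d ∣ n + 2),
        (ArithmeticFunction.liouville (n + 2) : ℝ) =
      ∑ n ∈ (Finset.Ioc x (2 * x)).filter (fun n : ℕ => ((∀ p ∈ n.primeFactors, z ≤ (p : ℝ)) ∧
        w ≤ ((n + 2).minFac : ℝ)) ∧ d ∣ n + 2), (ArithmeticFunction.liouville (n + 2) : ℝ) :=
      Finset.sum_congr (by ext n; simp only [Finset.mem_filter, and_assoc]) fun _ _ => rfl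
    have hlev : ∀ g ∈ Finset.Icc 1 ⌊L⌋₊, X₀ ≤ (2 * (x : ℝ) + 2) / ((d : ℝ) * g) ∧
        ((⌊L⌋₊ / g : ℕ) : ℝ) ≤ ((2 * (x : ℝ) + 2) / ((d : ℝ) * g)) ^ (1 / 2 : ℝ) /
          Real.log ((2 * (x : ℝ) + 2) / ((d : ℝ) * g)) ^ B ∧
        3 / 8 * Real.log (x : ℝ) ≤ Real.log ((2 * (x : ℝ) + 2) / ((d : ℝ) * g)) := by
      intro g hg
      rw [Finset.mem_Icc] at hg
      have hg1 : (1 : ℝ) ≤ g := by exact_mod_cast hg.1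
      have hgL : (g : ℝ) ≤ L := le_trans (by exact_mod_cast hg.2) (Nat.floor_le hL0.le)
      obtain ⟨w1, w2⟩ := twisted_window hε hx1.le hxexp (by exact_mod_cast hd1) hdD hg1 hgL
      obtain ⟨a1, a2, a3⟩ := twisted_level hB hx4 hxexp hT₃t hX₀t w1 w2
      refine ⟨a1, le_trans ?_ a2, a3⟩
      calc ((⌊L⌋₊ / g : ℕ) : ℝ) ≤ (⌊L⌋₊ : ℝ) := by exact_mod_cast Nat.div_le_self _ _
        _ ≤ L := Nat.floor_le hL0.le
    have hmain := twisted_Sd_le hC.le hCb hℓ0 hFL hBV hx1' hd1 hz2 hzw hwL hwy hdr hlev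
    rw [← hV] at hmain
    rw [e1] at *
    rw [abs_mul]
    have hμ := Summit.Parity.BatemanHorn.Theorems.OmegaToMobiusAP.abs_cast_moebius_le_one d
    have hS0 := abs_nonneg (∑ n ∈ (Finset.Ioc x (2 * x)).filter (fun n : ℕ =>
      ((∀ p ∈ n.primeFactors, z ≤ (p : ℝ)) ∧ w ≤ ((n + 2).minFac : ℝ)) ∧ d ∣ n + 2),
      (ArithmeticFunction.liouville (n + 2) : ℝ))
    have e2 : C * ((x : ℝ) / d + 1) * (2 * V / Real.log w) * Real.exp (-(Real.log L / Real.log w)) +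
        L ^ 2 + 2 * Cb * ((2 * (x : ℝ) + 2) / d) * (1 + Real.log L) / (3 / 8 * Real.log (x : ℝ)) ^ 3 =
      (C * x * (2 * V / Real.log w) * Real.exp (-(Real.log L / Real.log w)) +
        2 * Cb * (2 * (x : ℝ) + 2) * (1 + Real.log L) / (3 / 8 * Real.log (x : ℝ)) ^ 3) * (1 / (d : ℝ)) +
      (C * (2 * V / Real.log w) * Real.exp (-(Real.log L / Real.log w)) + L ^ 2) := by ring
    calc _ ≤ 1 * |∑ n ∈ (Finset.Ioc x (2 * x)).filter (fun n : ℕ =>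
          ((∀ p ∈ n.primeFactors, z ≤ (p : ℝ)) ∧ w ≤ ((n + 2).minFac : ℝ)) ∧ d ∣ n + 2),
          (ArithmeticFunction.liouville (n + 2) : ℝ)| := mul_le_mul_of_nonneg_right hμ hS0
      _ ≤ _ := by rw [one_mul, ← e2]; exact hmain
  -- Step C: the totals
  have hS₁ : ∑ d ∈ (Finset.Icc 1 ⌊Dr⌋₊).filter (fun d : ℕ => (d : ℝ) ≤ Dr ∧
      ∀ p ∈ d.primeFactors, y ≤ (p : ℝ)), (1 : ℝ) / d ≤ 5 / 2 * CR := by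
    have h := hRough y Dr hy1 hyD
    have hsub : (Finset.Icc 1 ⌊Dr⌋₊).filter (fun d : ℕ => (d : ℝ) ≤ Dr ∧
        ∀ p ∈ d.primeFactors, y ≤ (p : ℝ)) ⊆
        (Finset.Icc 1 ⌊Dr⌋₊).filter (fun n => ∀ p ∈ n.primeFactors, y ≤ ((p : ℕ) : ℝ)) := by
      intro d hd
      rw [Finset.mem_filter] at hd
      exact Finset.mem_filter.2 ⟨hd.1, hd.2.2⟩
    have hratio : Real.log Dr / Real.log y ≤ 5 / 2 := by
      have hlD : Real.log Dr = (1 / 2 - 2 * ε) * Real.log x := by rw [hDr, Real.log_rpow hx0]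
      have hly : Real.log y = 1 / 5 * Real.log x := by rw [hy, Real.log_rpow hx0]
      rw [hlD, hly, div_le_iff₀ (by positivity)]
      nlinarith
    have h2 : CR * (Real.log Dr / Real.log y) ^ 2 ^ 0 = CR * (Real.log Dr / Real.log y) := by
      rw [pow_zero, pow_one]
    have h' : ∑ d ∈ (Finset.Icc 1 ⌊Dr⌋₊).filter (fun n => ∀ p ∈ n.primeFactors, y ≤ ((p : ℕ) : ℝ)),
        (1 : ℝ) / d ≤ CR * (Real.log Dr / Real.log y) := by
      rw [← h2]
      refine le_trans (le_of_eq ?_) h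
      refine Finset.sum_congr rfl fun d _ => ?_
      rw [pow_zero]
    calc _ ≤ ∑ d ∈ (Finset.Icc 1 ⌊Dr⌋₊).filter (fun n => ∀ p ∈ n.primeFactors, y ≤ ((p : ℕ) : ℝ)),
            (1 : ℝ) / d := Finset.sum_le_sum_of_subset_of_nonneg hsub fun _ _ _ => by positivity
      _ ≤ CR * (Real.log Dr / Real.log y) := h'
      _ ≤ CR * (5 / 2) := mul_le_mul_of_nonneg_left hratio hCR.le
      _ = 5 / 2 * CR := by ring
  have hS₁0 : 0 ≤ ∑ d ∈ (Finset.Icc 1 ⌊Dr⌋₊).filter (fun d : ℕ => (d : ℝ) ≤ Dr ∧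
      ∀ p ∈ d.primeFactors, y ≤ (p : ℝ)), (1 : ℝ) / d :=
    Finset.sum_nonneg fun _ _ => by positivity
  have hcardD : (#((Finset.Icc 1 ⌊Dr⌋₊).filter (fun d : ℕ => (d : ℝ) ≤ Dr ∧
      ∀ p ∈ d.primeFactors, y ≤ (p : ℝ))) : ℝ) ≤ Real.exp (Real.exp t / 2) := by
    have h1 : #((Finset.Icc 1 ⌊Dr⌋₊).filter (fun d : ℕ => (d : ℝ) ≤ Dr ∧
        ∀ p ∈ d.primeFactors, y ≤ (p : ℝ))) ≤ ⌊Dr⌋₊ := by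
      calc _ ≤ #(Finset.Icc 1 ⌊Dr⌋₊) := Finset.card_filter_le _ _
        _ = ⌊Dr⌋₊ := by simp
    calc _ ≤ (⌊Dr⌋₊ : ℝ) := by exact_mod_cast h1
      _ ≤ Dr := Nat.floor_le hD0.le
      _ ≤ (x : ℝ) ^ ((1 : ℝ) / 2) := hDx
      _ = _ := hxhalf
  have hcardD' : (#((Finset.Icc 1 ⌊Dr⌋₊).filter (fun d : ℕ => (d : ℝ) ≤ Dr ∧
      ∀ p ∈ d.primeFactors, y ≤ (p : ℝ))) : ℝ) ≤ x := by
    refine hcardD.trans ?_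
    rw [← hxexp]; exact Real.exp_le_exp.2 (by linarith [Real.exp_pos t])
  -- `u = 1/(8ε²)`
  have hu0 : 0 < 1 / (8 * ε ^ 2) := by positivity
  have hE : Real.exp (-(Real.log L / Real.log w)) = Real.exp (-(1 / (8 * ε ^ 2))) := by
    rw [hlogL, hlogw]; congr 1; field_simp
  have hVw : 2 * V / Real.log w = 16 * (1 / (8 * ε ^ 2)) * V / Real.log (x : ℝ) := by
    rw [hlogw, hlogx']; field_simp; ring
  have hue : 1 / (8 * ε ^ 2) * Real.exp (-(1 / (8 * ε ^ 2))) ≤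
      δ / (64 * C * (5 / 2 * CR + 1) + 1) := by
    refine (mul_exp_neg_le hu0).trans ?_
    have e1 : 2 / (1 / (8 * ε ^ 2)) = 16 * ε ^ 2 := by field_simp; ring
    rw [e1]
    have hε1 : ε ≤ 1 := by linarith
    have : ε ^ 2 ≤ ε := by nlinarith
    linarith
  have hη : 64 * C * (5 / 2 * CR + 1) * (δ / (64 * C * (5 / 2 * CR + 1) + 1)) ≤ δ := by
    rw [mul_div_assoc', div_le_iff₀ hKM0]; nlinarith
  -- the three comparisons
  have hM := twisted_main_le (ℓ := Real.log (x : ℝ)) hC.le hV0.le hx0.le hlogpos hu0.le hue hη hS₁ hS₁0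
    hcardD' (Nat.cast_nonneg _)
  have hLsq := twisted_Lsq_le hδ hc ht0 hVc hT₆t hT₇t hcardD
  rw [← hLexp, hxexp, hexpt] at hLsq
  have hR := twisted_rem_le (S₁ := ∑ d ∈ (Finset.Icc 1 ⌊Dr⌋₊).filter (fun d : ℕ => (d : ℝ) ≤ Dr ∧
      ∀ p ∈ d.primeFactors, y ≤ (p : ℝ)), (1 : ℝ) / d) hδ hc hCb hCR ht1 hx4 hVc hS₁ hS₁0 hT₅t
  rw [← hlogL] at hR
  rw [hexpt] at hR
  -- assemble
  refine (Finset.abs_sum_le_sum_abs _ _).trans ((Finset.sum_le_sum hSd).trans ?_)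
  rw [sum_affine_inv, hE, hVw]
  have hV3 : 0 ≤ δ * V * x / Real.log (x : ℝ) := by positivity
  have hsum3 := add_le_add (add_le_add hM hR) hLsq
  ring_nf at hsum3 hV3 ⊢
  linarith

/-- **The crux `PlainSplit`** (route `ParityLeakOneFifth`, stmt-Parity-18382), BY NAME:
`CalibratedE1 → PintzDensity → E1NonSaturation` — line `calib-split` complete. -/
theorem plainSplit : Summit.Parity.GeneralizedHardyLittlewood.Theses.ParityLeakOneFifth.PlainSplit :=
  plainSplit_of_twisted stub_roughLiouvilleTwistedSmall

end Summit.Parity.GeneralizedHardyLittlewood.Theorems.ParityLeakOneFifth
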